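import Summits.BirchSwinnertonDyer.Rank1Residual.AdditivePotMult.RankZeroChiBranch
import Summits.BirchSwinnertonDyer.Rank1Residual.AdditivePotMult.RankZeroChiBranchThree
import Summits.BirchSwinnertonDyer.Rank1Residual.GaloisImage.PotMultLargeImage
import Summits.BirchSwinnertonDyer.Rank1Residual.X11b.MultiplicativeSurjectivityTwist
import HarnessLib

/-!
# X4(M), analytic rank `0`: the branch-side upper half with the IMAGE hypothesis discharged (`p ≥ 11`, or `p ∤ ord_p j(E)`)

HONEST FRAMING (cell `b2b-bsdres`, run/shared/lean/b2b/bsd-rank1-residual/, verbatim in every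
file): the goal of the cell is to DELETE the COMBINATION-SHAPED residual classes of the
Birch–Swinnerton-Dyer formula for ALL analytic-rank `≤ 1` elliptic curves over `ℚ` — "full BSD
formula for every rank `≤ 1` curve in class `C`" assembled STRICTLY from published theorems — so
that the rank-`≤ 1` remainder becomes exactly the CONSTRUCTION-SHAPED classes, which are TYPED
(missing-input `Prop`s), NOT attempted. This is not "finishing BSD". Sub-cell
`b2b-bsdres-additive-p1` (CLASS-OWNERS row "X3/X4 additive — pot. multiplicative / X3♯(M)"),
generation 6; research route, no claim beyond the stated sub-classes; X4(M) REMAINS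
CONSTRUCTION-SHAPED; nothing is booked.

Theorems only; no definition, no named fact. Corollaries of `RankZeroChiBranch.lean` (gen 6) with the
`Surj W p` binder DISCHARGED by the two image theorems landed for this sub-cell by x11c and
multr1-p2: `ClassX4M.surj_of_eleven_le` (Balakrishnan–Dogra–Müller–Tuitman–Vonk 2019 Thm. 1.2 + Serre
1972, named fact `thm12_not_le_normalizer_splitCartan`) and `ClassX4M.surj_of_not_dvd_padicValRat_j`
(Silverman *ATAEC* V.6.1 at `ℓ = p` + Serre Prop. 15; a tree theorem). So on X4(M) ∧ `r_an = 0`: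

* at `p ≥ 11` the hypotheses of the rank-zero upper half are EXACTLY: the class, `r_an = 0`, and the
  typed `χ_p`-branch input — no image, Tamagawa, Manin or `j`-witness condition
  (`ClassX4M.missingUpperBoundAt_rankZero_of_chiBranch_of_eleven_le`, `…bsdp…_of_shaAn_unit_of_eleven_le`);
* at any odd `p ≠ 3` the same on the decidable sub-population `p ∤ ord_p j(E)` (`…_of_not_dvd_padicValRat_j`).

Labels UNCHANGED; nothing booked.
-/

noncomputable section

open scoped Classical

open WeierstrassCurve Literature.NumberTheory.EllipticCurves
  Literature.NumberTheory.EllipticCurves.ModularForms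
  Literature.NumberTheory.EllipticCurves.Rank1Residual
  Literature.NumberTheory.EllipticCurves.Rank1Residual.Typed
  Literature.NumberTheory.EllipticCurves.BalakrishnanEtAl2019

namespace Summit.BirchSwinnertonDyer.Rank1Residual.AdditivePotMult

open Additive GaloisImage

variable {W : WeierstrassCurve ℚ} [W.IsElliptic] [W.IsGloballyMinimal] {p : ℕ} [hp : Fact p.Prime]

/-- **X4(M), `r_an = 0`, `p ≥ 11`: the upper half of `BSD(E,p)` from the typed `χ_p`-branch input with
NO image hypothesis** (`Irr ⇒ Surj` at a potentially multiplicative `p ≥ 11`, x11c's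
`ClassX4M.surj_of_eleven_le`). [cite: BalakrishnanEtAl2019, §1 Thm. 1.2 (arXiv:1711.05846 p. 2)]
[cite: Delbourgo1998, Prop. 4 (p. 144)] -/
theorem ClassX4M.missingUpperBoundAt_rankZero_of_chiBranch_of_eleven_le
    (hB : thm12_not_le_normalizer_splitCartan)
    (hDel : Delbourgo1998.prop4_rankZero_pow_dvd_constantCoeff)
    (hGZK : rank_eq_analyticRank_of_analyticRank_le_one) (hmod : hasEntireLFunction_rat)
    (hmodD : nonempty_modularParametrizationData)
    (hBCeven : ChiBranchLeadingTermBigImageAt W p) (hBCodd : ChiBranchLeadingTermOddBigImageAt W p)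
    (hX : ClassX4M W p) (hr : W.analyticRank = 0) (h11 : 11 ≤ p) : MissingUpperBoundAt W p :=
  ClassX4M.missingUpperBoundAt_rankZero_of_chiBranch hDel hGZK hmod hmodD hBCeven hBCodd hX hr
    (ClassX4M.surj_of_eleven_le hB hX h11) (fun h3 ↦ by omega)

/-- **X4(M), `r_an = 0`, `p ≥ 11`, `p ∤ #Ш_an(E)`: `BSD(E,p)` from the typed `χ_p`-branch input with NO
image, Tamagawa or Manin hypothesis.** [cite: BalakrishnanEtAl2019, §1 Thm. 1.2 (arXiv:1711.05846 p. 2)]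
[cite: Delbourgo1998, Prop. 4 (p. 144)] -/
theorem ClassX4M.bsdp_rankZero_of_chiBranch_of_shaAn_unit_of_eleven_le
    (hB : thm12_not_le_normalizer_splitCartan)
    (hDel : Delbourgo1998.prop4_rankZero_pow_dvd_constantCoeff)
    (hGZK : rank_eq_analyticRank_of_analyticRank_le_one) (hmod : hasEntireLFunction_rat)
    (hmodD : nonempty_modularParametrizationData)
    (hBCeven : ChiBranchLeadingTermBigImageAt W p) (hBCodd : ChiBranchLeadingTermOddBigImageAt W p)
    (hX : ClassX4M W p) (hr : W.analyticRank = 0) (h11 : 11 ≤ p)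
    {q : ℚ} (hq : shaAn W = (q : ℂ)) (hv : padicValRat p q = 0) : BSDp W p :=
  ClassX4M.bsdp_rankZero_of_chiBranch_of_shaAn_unit hDel hGZK hmod hmodD hBCeven hBCodd hX hr
    (ClassX4M.surj_of_eleven_le hB hX h11) (fun h3 ↦ by omega) hq hv

/-- **X4(M), `r_an = 0`, odd `p ≠ 3` with `p ∤ ord_p j(E)`: the upper half from the typed `χ_p`-branch
input with NO image hypothesis** (multr1-p2's `ClassX4M.surj_of_not_dvd_padicValRat_j`).
[cite: SilvermanATAEC1994, V.6 Prop. 6.1 (p. 410) and V.5.3] [cite: Delbourgo1998, Prop. 4 (p. 144)] -/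
theorem ClassX4M.missingUpperBoundAt_rankZero_of_chiBranch_of_not_dvd_padicValRat_j
    (hDel : Delbourgo1998.prop4_rankZero_pow_dvd_constantCoeff)
    (hGZK : rank_eq_analyticRank_of_analyticRank_le_one) (hmod : hasEntireLFunction_rat)
    (hmodD : nonempty_modularParametrizationData)
    (hBCeven : ChiBranchLeadingTermBigImageAt W p) (hBCodd : ChiBranchLeadingTermOddBigImageAt W p)
    (hX : ClassX4M W p) (hr : W.analyticRank = 0) (hp3 : p ≠ 3)
    (hj : ¬ (p : ℤ) ∣ padicValRat p W.j) : MissingUpperBoundAt W p :=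
  ClassX4M.missingUpperBoundAt_rankZero_of_chiBranch hDel hGZK hmod hmodD hBCeven hBCodd hX hr
    (ClassX4M.surj_of_not_dvd_padicValRat_j hX hj) (fun h3 ↦ absurd h3 hp3)

/-- **X4(M), `r_an = 0`, odd `p ≠ 3`, `p ∤ ord_p j(E)`, `p ∤ #Ш_an(E)`: `BSD(E,p)` from the typed
`χ_p`-branch input.** [cite: SilvermanATAEC1994, V.6 Prop. 6.1 (p. 410) and V.5.3]
[cite: Delbourgo1998, Prop. 4 (p. 144)] -/
theorem ClassX4M.bsdp_rankZero_of_chiBranch_of_shaAn_unit_of_not_dvd_padicValRat_j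
    (hDel : Delbourgo1998.prop4_rankZero_pow_dvd_constantCoeff)
    (hGZK : rank_eq_analyticRank_of_analyticRank_le_one) (hmod : hasEntireLFunction_rat)
    (hmodD : nonempty_modularParametrizationData)
    (hBCeven : ChiBranchLeadingTermBigImageAt W p) (hBCodd : ChiBranchLeadingTermOddBigImageAt W p)
    (hX : ClassX4M W p) (hr : W.analyticRank = 0) (hp3 : p ≠ 3)
    (hj : ¬ (p : ℤ) ∣ padicValRat p W.j) {q : ℚ} (hq : shaAn W = (q : ℂ)) (hv : padicValRat p q = 0) :
    BSDp W p :=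
  ClassX4M.bsdp_rankZero_of_chiBranch_of_shaAn_unit hDel hGZK hmod hmodD hBCeven hBCodd hX hr
    (ClassX4M.surj_of_not_dvd_padicValRat_j hX hj) (fun h3 ↦ absurd h3 hp3) hq hv

/-! ### X3♯(M) at `p ≥ 5`: the `p ∤ c_p(E)` binder discharged -/

/-- **X3♯(M), `r_an = 0`, `p ≥ 5`: the upper half from the typed `χ_p`-branch input with NO
Tamagawa hypothesis at all** — at an additive prime `c_p(E) ≤ 4 < p` (Kodaira–Néron; additive-p4's
`tamagawaNumberAt_ne_zero_and_le_four_of_addv`). [cite: SilvermanATAEC1994, IV.9.2 (d)]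
[cite: Delbourgo1998, Prop. 4 (p. 144)] -/
theorem ClassX3M.missingUpperBoundAt_rankZero_of_chiBranch_of_five_le
    (hDel : Delbourgo1998.prop4_rankZero_pow_dvd_constantCoeff)
    (hGZK : rank_eq_analyticRank_of_analyticRank_le_one) (hmod : hasEntireLFunction_rat)
    (hmodD : nonempty_modularParametrizationData)
    (hBCeven : ChiBranchLeadingTermAt W p) (hBCodd : ChiBranchLeadingTermOddAt W p)
    (hX : ClassX3M W p) (hr : W.analyticRank = 0) (hp5 : 5 ≤ p) : MissingUpperBoundAt W p := by
  refine ClassX3M.missingUpperBoundAt_rankZero_of_chiBranch hDel hGZK hmod hmodD hBCeven hBCodd hX hr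
    fun h ↦ ?_
  obtain ⟨h0, h4⟩ := tamagawaNumberAt_ne_zero_and_le_four_of_addv W p hX.potMult.1
  exact h0 (Nat.eq_zero_of_dvd_of_lt h (by omega))

/-- **X3♯(M), `r_an = 0`, `p ≥ 5`, `p ∤ #Ш_an(E)`: `BSD(E,p)` from the typed `χ_p`-branch input**
(no Tamagawa hypothesis). [cite: Delbourgo1998, Prop. 4 (p. 144)] -/
theorem ClassX3M.bsdp_rankZero_of_chiBranch_of_shaAn_unit_of_five_le
    (hDel : Delbourgo1998.prop4_rankZero_pow_dvd_constantCoeff)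
    (hGZK : rank_eq_analyticRank_of_analyticRank_le_one) (hmod : hasEntireLFunction_rat)
    (hmodD : nonempty_modularParametrizationData)
    (hBCeven : ChiBranchLeadingTermAt W p) (hBCodd : ChiBranchLeadingTermOddAt W p)
    (hX : ClassX3M W p) (hr : W.analyticRank = 0) (hp5 : 5 ≤ p)
    {q : ℚ} (hq : shaAn W = (q : ℂ)) (hv : padicValRat p q = 0) : BSDp W p :=
  bsdp_of_missingPPartAt W p hGZK (by rw [hr]; exact zero_le_one)
    (missingPPartAt_of_upper_of_shaAn_unit W p
      (ClassX3M.missingUpperBoundAt_rankZero_of_chiBranch_of_five_le hDel hGZK hmod hmodD hBCeven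
        hBCodd hX hr hp5) hq hv)

/-! ### §4 (gen 7) ANY odd `p`, `p = 3` INCLUDED: the image bit decided by `p ∤ ord_p j(E)`, the `ram` / Tamagawa binders gone -/

/-- **X4(M), `r_an = 0`, ANY odd `p` with `p ∤ ord_p j(E)` (`p = 3` included): the upper half of
`BSD(E,p)` from the typed `χ_p`-branch input with NO census binder at all** — `surj(p)` is decided
in the kernel by `p ∤ ord_p j(E)` (`ClassX4M.surj_of_not_dvd_padicValRat_j`: at a potentially
multiplicative `p` the inertia at `p` supplies a transvection), and the former `p = 3 → ram(3)`
premise is gone (`RankZeroChiBranchThree.lean`: Wuthrich 2014 Lemma 20 on the multiplicative twist,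
`hL20`). E.g. the window pair 13221g1 at `p = 3` (`ord_3 j = −19`, `3 ∣ ∏c_ℓ = 24`, `#Ш_an = 9`),
structurally outside the Heegner-index route, is reached (with the lower half, next theorem but one).
X4(M) stays CONSTRUCTION-SHAPED; nothing booked. [cite: SilvermanATAEC1994, V.6 Prop. 6.1 (p. 410) and V.5.3]
[cite: Wuthrich2014, Lemma 20 (p. 399)] [cite: Delbourgo1998, Prop. 4 (p. 144)] -/
theorem ClassX4M.missingUpperBoundAt_rankZero_of_chiBranch_of_not_dvd_padicValRat_j_of_odd
    (hDel : Delbourgo1998.prop4_rankZero_pow_dvd_constantCoeff)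
    (hGZK : rank_eq_analyticRank_of_analyticRank_le_one) (hmod : hasEntireLFunction_rat)
    (hmodD : nonempty_modularParametrizationData)
    (hL20 : Wuthrich2014.lemma20_surjective_threeAdic_of_semistable)
    (hBCeven : ChiBranchLeadingTermBigImageAt W p) (hBCodd : ChiBranchLeadingTermOddBigImageAt W p)
    (hX : ClassX4M W p) (hr : W.analyticRank = 0) (hj : ¬ (p : ℤ) ∣ padicValRat p W.j) :
    MissingUpperBoundAt W p := by
  by_cases hp3 : p = 3
  · subst hp3
    exact ClassX4M.missingUpperBoundAt_three_rankZero_of_chiBranch_of_surj hDel hGZK hmod hmodD hL20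
      hBCodd hX hr (ClassX4M.surj_of_not_dvd_padicValRat_j hX hj)
  · exact ClassX4M.missingUpperBoundAt_rankZero_of_chiBranch_of_not_dvd_padicValRat_j hDel hGZK hmod
      hmodD hBCeven hBCodd hX hr hp3 hj

/-- **X4(M), `r_an = 0`, ANY odd `p`, `p ∤ ord_p j(E)`, `p ∤ #Ш_an(E)`: `BSD(E,p)` from the typed
`χ_p`-branch input alone.** [cite: Wuthrich2014, Lemma 20 (p. 399)] [cite: Delbourgo1998, Prop. 4 (p. 144)] -/
theorem ClassX4M.bsdp_rankZero_of_chiBranch_of_shaAn_unit_of_not_dvd_padicValRat_j_of_odd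
    (hDel : Delbourgo1998.prop4_rankZero_pow_dvd_constantCoeff)
    (hGZK : rank_eq_analyticRank_of_analyticRank_le_one) (hmod : hasEntireLFunction_rat)
    (hmodD : nonempty_modularParametrizationData)
    (hL20 : Wuthrich2014.lemma20_surjective_threeAdic_of_semistable)
    (hBCeven : ChiBranchLeadingTermBigImageAt W p) (hBCodd : ChiBranchLeadingTermOddBigImageAt W p)
    (hX : ClassX4M W p) (hr : W.analyticRank = 0) (hj : ¬ (p : ℤ) ∣ padicValRat p W.j)
    {q : ℚ} (hq : shaAn W = (q : ℂ)) (hv : padicValRat p q = 0) : BSDp W p :=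
  bsdp_of_missingPPartAt W p hGZK (by rw [hr]; exact zero_le_one)
    (missingPPartAt_of_upper_of_shaAn_unit W p
      (ClassX4M.missingUpperBoundAt_rankZero_of_chiBranch_of_not_dvd_padicValRat_j_of_odd hDel hGZK
        hmod hmodD hL20 hBCeven hBCodd hX hr hj) hq hv)

/-- **X4(M), `r_an = 0`, ANY odd `p`, `p ∤ ord_p j(E)`: `BSD(E,p)` from the typed `χ_p`-branch
input and the LOWER half over `ℚ`** (the `p ∣ #Ш_an` rows).
[cite: Wuthrich2014, Lemma 20 (p. 399)] [cite: Delbourgo1998, Prop. 4 (p. 144)] -/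
theorem ClassX4M.bsdp_rankZero_of_chiBranch_of_lower_of_not_dvd_padicValRat_j_of_odd
    (hDel : Delbourgo1998.prop4_rankZero_pow_dvd_constantCoeff)
    (hGZK : rank_eq_analyticRank_of_analyticRank_le_one) (hmod : hasEntireLFunction_rat)
    (hmodD : nonempty_modularParametrizationData)
    (hL20 : Wuthrich2014.lemma20_surjective_threeAdic_of_semistable)
    (hBCeven : ChiBranchLeadingTermBigImageAt W p) (hBCodd : ChiBranchLeadingTermOddBigImageAt W p)
    (hX : ClassX4M W p) (hr : W.analyticRank = 0) (hj : ¬ (p : ℤ) ∣ padicValRat p W.j)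
    (hlow : MissingLowerBoundAt W p) : BSDp W p :=
  bsdp_of_missingPPartAt W p hGZK (by rw [hr]; exact zero_le_one)
    (missingPPartAt_of_lower_of_upper W p hlow
      (ClassX4M.missingUpperBoundAt_rankZero_of_chiBranch_of_not_dvd_padicValRat_j_of_odd hDel hGZK
        hmod hmodD hL20 hBCeven hBCodd hX hr hj))

end Summit.BirchSwinnertonDyer.Rank1Residual.AdditivePotMult

end
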